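import Summits.CriticalPhenomena.SAWScalingLimit.Theorems.SAWReversalUpgradePathUpgradeRSLEHullPackage
import Summits.CriticalPhenomena.SAWScalingLimit.Theorems.SAWReversalUpgradePathUpgradeRRangeBoundAux
import Literature.Probability.RandomPlanarGeometry.BoundaryCorrespondence
import HarnessLib

/-!
# `stub_sleNoEscape` — the "no escape" quantile lemma of the SLE_{8/3} reference sample
(crux `PathUpgradeR`, stmt-CriticalPhenomena-18055, route `SAWReversalUpgrade`, line `bidir_windows`)

Landing target:
`Summits/CriticalPhenomena/SAWScalingLimit/Theorems/SAWReversalUpgradePathUpgradeRSLENoEscape.lean`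
(`--supports stmt-CriticalPhenomena-18055`; registered stub `stub_sleNoEscape` of
`Cruxes/PathUpgradeR/Lines/bidir_windows.lean`, statement verbatim).

**Theorem.** Let `(E; a, b)` be a Dobrushin domain with chordal uniformizing map `ψ` (boundary
extension `ψ̄`, `ψ̄ ∞ = b = E.pt 1`), let `γ` be the SLE_{8/3} trace and `r = ψ̄ ∘ γ`. For every
`ρ₁ > 0` and every budget `β > 0` there is `ρ₂ > 0` with
`P' {∃ u ≤ u', ρ₁ < dist (r u') b ∧ dist (r u) b < ρ₂} ≤ β`:
once the image curve has come `ρ₂`-close to `b` it does not escape to distance `ρ₁` again, up to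
an event of probability `≤ β`.

**Proof.** Almost surely `r t → b` (transience of SLE_κ for `κ ≠ 8`, Rohde–Schramm (2005)
Thm. 7.1, `tendsto_norm_sleTrace_atTop_of_ne_eight`, composed with `ψ̄ z → b` as `z → ∞` in
`{0 ≤ im}`, `MarkedDomain.IsChordalUniformizing.tendsto_boundaryExtension_cocompact`), so there is
`T₀(ω)` with `dist (r t) b ≤ ρ₁` for `t ≥ T₀`; `r` is continuous and never equal to `b`
(`MarkedDomain.boundaryExtension_ne_pt_one`), so `m(ω) = min_{[0, T₀ + 1]} dist (r ·) b > 0`, and the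
bad event fails for `ρ₂ ≤ m(ω)`. Measurability: both inequalities are strict and `r` is continuous,
so the bad event with `ρ₂ = 1/(n+1)` is contained in the countable union `B n` over times `q, q'` of
a countable dense set with `q < q' + 1` of `{ρ₁ < dist (r q') b} ∩ {dist (r q) b < 1/(n+1)}`
(measurable by `measurable_sleTrace`); `B n` decreases to an a.s. empty set, and continuity from
above (`MeasureTheory.tendsto_measure_iInter_atTop`) gives `n` with `P' (B n) ≤ β`. [folklore]
-/

noncomputable section

open scoped ENNReal NNReal Topology
open MeasureTheory Filter Set Metric TopologicalSpace
open Literature.Probability Literature.Probability.RandomPlanarGeometry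
open UpperHalfPlane (upperHalfPlaneSet)

namespace Summit.CriticalPhenomena.SAWScalingLimit.Theorems

namespace PathUpgradeRSLERegNoEscape

/-! ### Deterministic core -/

/-- A continuous positive function on `[0, ∞)` which is `≤ ρ₁` after time `T₀` is bounded below by
a positive constant at every time `q` with `q < q' + 1` for some `q'` where it exceeds `ρ₁`
(such `q'` are `< T₀`, so `q ∈ [0, T₀ + 1]`, a compact on which the minimum is attained and
positive). [folklore] -/
theorem exists_pos_forall_le {f : ℝ≥0 → ℝ} (hf : Continuous f) (hpos : ∀ t, 0 < f t) {ρ₁ : ℝ}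
    {T₀ : ℝ≥0} (hT₀ : ∀ t, T₀ ≤ t → f t ≤ ρ₁) :
    ∃ m : ℝ, 0 < m ∧ ∀ q q' : ℝ≥0, q < q' + 1 → ρ₁ < f q' → m ≤ f q := by
  obtain ⟨s₀, -, hmin⟩ :=
    (isCompact_Icc : IsCompact (Icc (0 : ℝ≥0) (T₀ + 1))).exists_isMinOn
      ⟨0, left_mem_Icc.2 zero_le⟩ hf.continuousOn
  refine ⟨f s₀, hpos s₀, fun q q' hqq' hq' ↦ isMinOn_iff.1 hmin q ⟨zero_le, ?_⟩⟩
  have hq'T : q' < T₀ := lt_of_not_ge fun h ↦ (not_le.2 hq') (hT₀ q' h)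
  have hq'T₁ : q' + 1 < T₀ + 1 := by gcongr
  exact (hqq'.trans hq'T₁).le

/-- Approximation of a bad pair of times by times of a dense set: if `u ≤ u'` with `ρ₁ < f u'`
and `f u < ρ₂` for a continuous `f`, then there are `q, q'` in the dense set `S` with
`q < q' + 1`, `ρ₁ < f q'` and `f q < ρ₂` (both conditions are open). [folklore] -/
theorem exists_mem_dense_pair {f : ℝ≥0 → ℝ} (hf : Continuous f) {S : Set ℝ≥0} (hS : Dense S)
    {ρ₁ ρ₂ : ℝ} {u u' : ℝ≥0} (huu' : u ≤ u') (hu' : ρ₁ < f u') (hu : f u < ρ₂) :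
    ∃ q ∈ S, ∃ q' ∈ S, q < q' + 1 ∧ ρ₁ < f q' ∧ f q < ρ₂ := by
  have hopen₁ : IsOpen {s : ℝ≥0 | s < u' + 1 ∧ f s < ρ₂} :=
    (isOpen_lt continuous_id continuous_const).inter (isOpen_lt hf continuous_const)
  obtain ⟨q, hqS, hqu', hq⟩ := hS.exists_mem_open hopen₁
    ⟨u, lt_of_le_of_lt huu' (lt_add_one u'), hu⟩
  have hopen₂ : IsOpen {s : ℝ≥0 | q < s + 1 ∧ ρ₁ < f s} :=
    (isOpen_lt continuous_const (continuous_id.add continuous_const)).inter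
      (isOpen_lt continuous_const hf)
  obtain ⟨q', hq'S, hqq', hq'⟩ := hS.exists_mem_open hopen₂ ⟨u', hqu', hu'⟩
  exact ⟨q, hqS, q', hq'S, hqq', hq', hq⟩

/-! ### The quantile lemma for a general `κ` under a.s. transience of the image curve -/

/-- **No escape, general form.** If a.s. `φ̄ (γ t) → D.pt 1` (for the SLE_κ trace `γ` and the
boundary extension `φ̄` of a chordal uniformizing map of `D`), then for every `ρ₁ > 0` and `β ≠ 0`
some `n` has `P' {∃ u ≤ u', ρ₁ < dist (φ̄ (γ u')) b ∧ dist (φ̄ (γ u)) b < 1/(n+1)} ≤ β`.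
Continuity from above along the measurable supersets `B n` (countable dense set of times) with
a.s. empty intersection (`exists_pos_forall_le`, `φ̄ (γ t) ≠ b`). [folklore] -/
theorem exists_measure_noEscape_le {κ : ℝ≥0} {D : DobrushinDomain}
    {φ : ConformalEquiv upperHalfPlaneSet D.carrier} (hφ : D.IsChordalUniformizing φ)
    (hB : ∀ᵐ ω ∂Process.preWienerMeasure, ∀ ε : ℝ, 0 < ε → ∃ T₀ : ℝ≥0, ∀ t : ℝ≥0, T₀ ≤ t →
      dist (φ.boundaryExtension (sleTrace κ ω t)) (D.pt 1) ≤ ε)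
    {ρ₁ : ℝ} (hρ₁ : 0 < ρ₁) {β : ℝ≥0∞} (hβ : β ≠ 0) :
    ∃ n : ℕ, Process.preWienerMeasure {ω | ∃ u u' : ℝ≥0, u ≤ u' ∧
      ρ₁ < dist (φ.boundaryExtension (sleTrace κ ω u')) (D.pt 1) ∧
      dist (φ.boundaryExtension (sleTrace κ ω u)) (D.pt 1) < 1 / ((n : ℝ) + 1)} ≤ β := by
  haveI : IsProbabilityMeasure Process.preWienerMeasure := isProbabilityMeasure_preWienerMeasure'
  have hΦc : Continuous fun z ↦ φ.boundaryExtension (Loewner.liftIm 0 z) :=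
    continuous_boundaryExtension_liftIm φ
  have hfeq : ∀ (ω : ℝ≥0 → ℝ) (t : ℝ≥0),
      φ.boundaryExtension (Loewner.liftIm 0 (sleTrace κ ω t)) =
        φ.boundaryExtension (sleTrace κ ω t) := fun ω t ↦ by
    rw [Loewner.liftIm_of_le (sleTrace_im_nonneg κ ω t)]
  have hfm : ∀ t : ℝ≥0, Measurable fun ω : ℝ≥0 → ℝ ↦
      dist (φ.boundaryExtension (sleTrace κ ω t)) (D.pt 1) := by
    intro t
    have h : (fun ω : ℝ≥0 → ℝ ↦ dist (φ.boundaryExtension (sleTrace κ ω t)) (D.pt 1)) =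
        fun ω ↦ dist (φ.boundaryExtension (Loewner.liftIm 0 (sleTrace κ ω t))) (D.pt 1) := by
      funext ω
      rw [hfeq]
    rw [h]
    exact (hΦc.measurable.comp (measurable_sleTrace κ t)).dist measurable_const
  have hfc : ∀ ω : ℝ≥0 → ℝ, Continuous fun t : ℝ≥0 ↦
      dist (φ.boundaryExtension (sleTrace κ ω t)) (D.pt 1) := fun ω ↦
    ((continuousOn_boundaryExtension_im_nonneg φ).comp_continuous (continuous_sleTrace κ ω)
      (sleTrace_im_nonneg κ ω)).dist continuous_const
  have hfpos : ∀ (ω : ℝ≥0 → ℝ) (t : ℝ≥0),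
      0 < dist (φ.boundaryExtension (sleTrace κ ω t)) (D.pt 1) := fun ω t ↦
    dist_pos.2 (MarkedDomain.boundaryExtension_ne_pt_one
      JordanDomain.exists_continuousOn_extension_holds hφ (sleTrace_im_nonneg κ ω t))
  obtain ⟨S, hSc, hSd⟩ := TopologicalSpace.exists_countable_dense ℝ≥0
  obtain ⟨B, hBmem⟩ : ∃ B : ℕ → Set (ℝ≥0 → ℝ), ∀ n ω, ω ∈ B n ↔ ∃ q ∈ S, ∃ q' ∈ S, q < q' + 1 ∧
      ρ₁ < dist (φ.boundaryExtension (sleTrace κ ω q')) (D.pt 1) ∧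
      dist (φ.boundaryExtension (sleTrace κ ω q)) (D.pt 1) < 1 / ((n : ℝ) + 1) :=
    ⟨fun n ↦ {ω | ∃ q ∈ S, ∃ q' ∈ S, q < q' + 1 ∧
      ρ₁ < dist (φ.boundaryExtension (sleTrace κ ω q')) (D.pt 1) ∧
      dist (φ.boundaryExtension (sleTrace κ ω q)) (D.pt 1) < 1 / ((n : ℝ) + 1)},
      fun _ _ ↦ Iff.rfl⟩
  have hBm : ∀ n, MeasurableSet (B n) := by
    intro n
    have hrep : B n = ⋃ q ∈ S, ⋃ q' ∈ S, {ω | q < q' + 1 ∧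
        ρ₁ < dist (φ.boundaryExtension (sleTrace κ ω q')) (D.pt 1) ∧
        dist (φ.boundaryExtension (sleTrace κ ω q)) (D.pt 1) < 1 / ((n : ℝ) + 1)} := by
      ext ω
      simp only [hBmem, mem_iUnion, mem_setOf_eq, exists_prop]
    rw [hrep]
    refine MeasurableSet.biUnion hSc fun q _ ↦ MeasurableSet.biUnion hSc fun q' _ ↦ ?_
    exact (MeasurableSet.const _).inter
      ((measurableSet_lt measurable_const (hfm q')).inter
        (measurableSet_lt (hfm q) measurable_const))
  have hanti : Antitone B := fun n n' hnn' ω hω ↦ by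
    obtain ⟨q, hqS, q', hq'S, hqq', hq', hq⟩ := (hBmem n' ω).1 hω
    exact (hBmem n ω).2 ⟨q, hqS, q', hq'S, hqq', hq', hq.trans_le (Nat.one_div_le_one_div hnn')⟩
  have hnull : Process.preWienerMeasure (⋂ n, B n) = 0 := by
    rw [measure_eq_zero_iff_ae_notMem]
    filter_upwards [hB] with ω hω hmem
    obtain ⟨T₀, hT₀⟩ := hω ρ₁ hρ₁
    obtain ⟨m, hm, hmle⟩ := exists_pos_forall_le (hfc ω) (hfpos ω) hT₀
    obtain ⟨n, hn⟩ := exists_nat_one_div_lt hm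
    obtain ⟨q, -, q', -, hqq', hq', hq⟩ := (hBmem n ω).1 (mem_iInter.1 hmem n)
    exact absurd ((hmle q q' hqq' hq').trans_lt hq) (not_lt.2 hn.le)
  have htend := tendsto_measure_iInter_atTop (μ := Process.preWienerMeasure)
    (fun n ↦ (hBm n).nullMeasurableSet) hanti ⟨0, measure_ne_top _ _⟩
  rw [hnull] at htend
  obtain ⟨n, hn⟩ := (htend.eventually_lt_const (pos_iff_ne_zero.2 hβ)).exists
  refine ⟨n, (measure_mono ?_).trans hn.le⟩
  rintro ω ⟨u, u', huu', hu', hu⟩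
  exact (hBmem n ω).2 (exists_mem_dense_pair (hfc ω) hSd huu' hu' hu)

end PathUpgradeRSLERegNoEscape

open PathUpgradeRSLERegNoEscape in
/-- **No escape of the SLE_{8/3} reference sample** (registered stub `stub_sleNoEscape` of the
line `bidir_windows`, statement verbatim): for a Dobrushin domain `E` with chordal uniformizing map
`ψ`, every `ρ₁ > 0` and every `β > 0`, some `ρ₂ > 0` makes the event "the image curve `ψ̄ ∘ γ` is
`ρ₂`-close to `b = E.pt 1` at a time `u` and `ρ₁`-far from `b` at a later time `u'`" have
`P'`-measure `≤ β`. Transience of SLE_{8/3} (Rohde–Schramm (2005), Thm. 7.1) seen through `ψ̄`,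
positivity of `dist (ψ̄ (γ ·)) b` on compacts, and continuity from above
(`exists_measure_noEscape_le`). [folklore] -/
theorem stub_sleNoEscape : ∀ (E : Literature.Probability.RandomPlanarGeometry.DobrushinDomain) (ψ : Literature.Probability.RandomPlanarGeometry.ConformalEquiv UpperHalfPlane.upperHalfPlaneSet E.carrier), E.IsChordalUniformizing ψ → ∀ ρ₁ : ℝ, 0 < ρ₁ → ∀ β : ENNReal, 0 < β → ∃ ρ₂ : ℝ, 0 < ρ₂ ∧ Literature.Probability.Process.preWienerMeasure {ω | ∃ u u' : NNReal, u ≤ u' ∧ ρ₁ < dist (ψ.boundaryExtension (Literature.Probability.RandomPlanarGeometry.sleTrace ((8:NNReal)/3) ω u')) (E.pt 1) ∧ dist (ψ.boundaryExtension (Literature.Probability.RandomPlanarGeometry.sleTrace ((8:NNReal)/3) ω u)) (E.pt 1) < ρ₂} ≤ β := by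
  intro E ψ hψ ρ₁ hρ₁ β hβ
  have hκ0 : (0 : ℝ≥0) < 8 / 3 := by positivity
  have hB : ∀ᵐ ω ∂Process.preWienerMeasure, ∀ ε : ℝ, 0 < ε → ∃ T₀ : ℝ≥0, ∀ t : ℝ≥0, T₀ ≤ t →
      dist (ψ.boundaryExtension (sleTrace ((8 : ℝ≥0) / 3) ω t)) (E.pt 1) ≤ ε := by
    filter_upwards [tendsto_norm_sleTrace_atTop_of_ne_eight hκ0 eightThirds_ne_eight] with ω hω ε hε
    exact PathUpgradeRSLEHullPackage.exists_forall_dist_comp_le hω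
      (sleTrace_im_nonneg ((8 : ℝ≥0) / 3) ω) hψ.tendsto_boundaryExtension_cocompact hε
  obtain ⟨n, hn⟩ := exists_measure_noEscape_le hψ hB hρ₁ hβ.ne'
  exact ⟨1 / ((n : ℝ) + 1), by positivity, hn⟩

end Summit.CriticalPhenomena.SAWScalingLimit.Theorems

end
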